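import Literature.MathematicalPhysics.QuantumFieldTheory.Balaban1983to89.B9Eq3126GreenLettersVariational
import Literature.MathematicalPhysics.QuantumFieldTheory.Balaban1983to89.B11Eq111FrakG

/-!
# `Balaban1983to89.B9Eq3153FrakGVariational` — T. Bałaban, *Propagators for lattice gauge theories in a background field*, Commun. Math. Phys.
# **99** (1985) 389–434 [Balaban1985BackgroundPropagators] (3.153) p. 426 *«𝔊 = G₁ − G₁DRD*G₁ − G₁Q*(QG₁Q*)⁻¹QG₁ = G₁𝔓* = 𝔓G₁»* with Thm 3.13
# p. 426 and Thm 3.11 p. 416: **THE ENERGY CURRENCY FOR THE THIRD GREEN's LETTER `𝔊` — OPERATOR BOUNDS OF `G₁`, `H₁QG₁`, `G₁DRD*G₁` AND `𝔊`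
# (AND OF THEIR `D`-ROWS) FROM THE COERCIVITY CONSTANT `γ` OF `Δ_a` ALONE, WITH NO OPERATOR BOUND OF `Δ_a`, OF `D`, OF `Q`, AND NO LETTER FOR
# `H₁` OR `(QG₁Q*)⁻¹`** (abstract finite-dimensional `𝕜`-Hilbert letters for the pub-balaban NE9 chain's `B11Eq103H1Complex.G1K` ∕ `H1K` ∕
# `B11Eq111FrakG.frakGLin`)

statement-level skeleton of published theorems with citation tags; proofs where landed; nothing here is a claim about the Yang–Mills mass gap

CITATION HEADER (lean-in-tree rule).  Audit cell `pub-balaban`, sub-cell `t4`, BINDER row NE9; filed by the row OWNER lineage `b2b-balaban-t4-ne9-p1`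
(gen 86).  Sources READ first-hand by this lineage in the held text layer [Balaban1985BackgroundPropagators]
(`paper:balaban1985-cmp99-background-propagators`, journal page = PDF page + 388) pp. 399–400 (Thms 3.3∕3.4), 416 (Thm 3.11), 425–426
((3.146)–(3.153), Thm 3.13); [Balaban1985Variational] (45) p. 285, (110)–(111) p. 294 through the tree's render-verified quotations in
`B11Eq111FrakG` ∕ `B11Eq103H1Complex` ∕ `B9Eq3126GreenLettersVariational`.

THE PRINT (verbatim, text layer).  p. 426: *«The equalities (3.150), (3.152) give 𝔊 = G₁ − G₁DRD*G₁ − DG′RG′D* + DG′RG′D*DRG′D* = G₁ − G₁DRD*G₁ −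
G₁Q*(QG₁Q*)⁻¹QG₁ = G₁𝔓* = 𝔓G₁. (3.153)  The formulas (3.147), (3.153) permit us to reduce properties of the operators 𝔓, 𝔊 to the corresponding
properties of the operators G′, (Q′G′²Q′*)⁻¹, G₁, (QG₁Q*)⁻¹.  Especially for 𝔊 we have, assuming (3.132)  Theorem 3.13. If an external gauge field
configuration U satisfies the regularity conditions (3.35), (3.36) for α₀ sufficiently small, then Theorems 3.3, 3.10, 3.11 hold for the propagator 𝔊,
with the exception of the inequality in (3.42) involving the covariant Laplace operator.»*; p. 416, Thm 3.11: *«the operators Δ′_a, G′, (Q′G′²Q′*)⁻¹,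
Δ_a, G are positive definite»*; [B11] p. 285 (45): *«H … giving a minimum of the quadratic form ½⟨A, ΔA⟩ under the restrictions L^jηQ_jA = B»*.

WHY THIS FILE (cell context; TOWER-R-PROGRAMME §5 «next programme: level-free `H_{1,k}`∕`𝔊_k`»).  The chain's operator letter for `𝔊`
(`B9Eq3126GreenLetters.norm_frakGLin_le`, owner g80; instantiated per lattice by `B9Eq3126H1Bound` ∕ `B9Eq3126H1BoundTower` §3) reads
`‖𝔊‖ ≤ γ⁻¹(1 + M_Q·(γμ_Q²∕M_T²)⁻¹·M_Q·γ⁻¹ + M_D²γ⁻¹)` with `M_T` an OPERATOR bound of `Δ_a` (`∝ |η|⁻²` on the fine lattice), `M_D` an operator bound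
of `D` (`∝ |η|⁻¹`) and `μ_Q` the adjoint modulus of `Q` — on print's diagonal `ηL^{n+1} = 1` the constant `C_G` therefore grows like `L^{4(n+1)}`.
NE9 leaf-02's `B9Eq3126GreenLettersVariational` (g65) removed `M_T` from the `H₁`∕`(QG₁Q†)⁻¹` letters by the minimiser (45) and says in its scope
note: *«`𝔊 = G₁𝔓*` is NOT treated (its `DRD*G₁` term carries `‖D‖ ∝ |η|⁻¹` in the operator currency — a separate question)»*.  THIS FILE ANSWERS THAT
QUESTION: in the energy currency the three pieces of (3.153) are bounded by `γ` alone — (i) `G₁` by coercivity; (ii) `H₁QG₁y` is the minimiser of the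
energy on `{Qx = QG₁y}`, a constraint SATISFIED BY `G₁y` ITSELF, so its energy is at most `re⟨G₁y, y⟩ ≤ γ⁻¹‖y‖²` — no `H₁` letter, no test family, no
section; (iii) `G₁DRD*G₁ = (G₁DR)(RD*G₁)` and both factors are controlled by ONE displayed FORM letter `‖RD*x‖² ≤ c_R·re⟨x, Δ_a x⟩` (§5: `c_R = 1 + K∕γ`
from the structure `Δ_a = Δ + DRD* + aQ†Q` with `re⟨x, Δx⟩ ≥ −K‖x‖²`; `c_R = 1` when `Δ ≥ 0`), because the energy of `G₁(DRz)` is `re⟨RD*G₁DRz, z⟩`.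
Hence `‖𝔊‖ ≤ (2 + c_R)∕γ`, and for every operator `P` dominated by the energy (`‖Px‖² ≤ c_P·re⟨x, Δ_a x⟩` — the `D`-rows of a STRONG coercivity)
`‖P𝔊‖ ≤ (2 + c_R)√(c_P∕γ)`.  The k-level instance on print's diagonal (every letter discharged by the owner's `B9Thm311LaplaceAkPositiveDiagonal` ∕
`B9Thm311SmallFieldCoercivityTowerClosed`) is the sequel `B9Eq3153FrakGkBoundDiagonal`.

WHAT IS PROVED (sorry-free; 0 `def`; [folklore] finite-dimensional Hilbert-space algebra; nothing of [B9]∕[B11] asserted as printed).  Letters as in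
`B9Eq3126GreenLettersVariational`: `T := laplaceAK Δ D R D* Q Q† a` with displayed positivity `hpos`, `G₁ := G1K … hpos`, `H₁ := H1K hpos hadj hinj`,
`𝔊 := frakGLin G₁ Q Q† (KinvK hpos hadj hinj) D R D*`; a coercivity constant `γ‖x‖² ≤ re⟪x, Tx⟫` from §1 on.
* §1 `G₁` IN THE ENERGY CURRENCY: **`norm_G1K_le`** (`‖G₁y‖ ≤ γ⁻¹‖y‖`), `re_inner_G1K_laplaceAK_G1K` (the energy of `G₁y` is `re⟪G₁y, y⟫`),
  `sq_norm_G1K_le` (`γ‖G₁y‖² ≤ re⟪G₁y, y⟫`), `re_inner_G1K_nonneg`, **`re_inner_G1K_le`** (`re⟪G₁y, y⟫ ≤ γ⁻¹‖y‖²`).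
* §2 THE SANDWICH, for any `P : E →ₗ V` with `‖Px‖² ≤ c_P·re⟪x, Tx⟫`: **`norm_apply_G1K_le`** (`‖P(G₁y)‖ ≤ √(c_P∕γ)‖y‖`); with an adjoint partner
  `P′` (`⟪Px, v⟫ = ⟪x, P′v⟫`): **`re_inner_G1K_adj_le`** (the energy of `G₁(P′v)` is `≤ c_P‖v‖²`), **`norm_apply_G1K_adj_le'`** (`‖P₂(G₁(P′v))‖ ≤
  √(c₂c_P)‖v‖` for a second dominated `P₂`), `norm_apply_G1K_adj_le` (`‖P(G₁(P′v))‖ ≤ c_P‖v‖`), **`norm_G1K_adj_le`** (`‖G₁(P′v)‖ ≤ √(c_P∕γ)‖v‖`).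
* §3 (`T` symmetric) `H₁QG₁` WITH NO `H₁` LETTER: **`re_inner_H1K_Q_G1K_energy_le`** (energy `≤ re⟪G₁y, y⟫`, the minimiser (45) against the
  comparison configuration `G₁y` — leaf-02's `re_inner_laplaceAK_H1K_le` BY NAME), **`norm_H1K_Q_G1K_le`** (`‖H₁(Q(G₁y))‖ ≤ γ⁻¹‖y‖`),
  **`norm_apply_H1K_Q_G1K_le`** (`‖P(H₁(Q(G₁y)))‖ ≤ √(c_P∕γ)‖y‖`).
* §4 (`T` symmetric; `⟪Ds, x⟫ = ⟪s, D*x⟫`, `R` symmetric and idempotent; the FORM letter `‖R(D*x)‖² ≤ c_R·re⟪x, Tx⟫`) THE THIRD GREEN's LETTER: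
  `frakGLin_apply_H1K` ((3.153) read with `H₁`: `𝔊x = G₁x − H₁(Q(G₁x)) − G₁(D(R(D*(G₁x))))`), **`norm_frakGLin_le_of_energy`** (`‖𝔊x‖ ≤ (2 + c_R)γ⁻¹‖x‖`),
  **`norm_apply_frakGLin_le_of_energy`** (`‖P(𝔊x)‖ ≤ (2 + c_R)√(c_P∕γ)‖x‖`).
* §5 THE FORM LETTER FROM THE STRUCTURE (no symmetry of `T`; `⟪Ds, x⟫ = ⟪s, D*x⟫`, `R` symmetric idempotent, `re⟪x, Δx⟫ ≥ −K‖x‖²`, `0 ≤ re a`):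
  **`re_inner_laplaceAK_eq`** (`re⟪x, Tx⟫ = re⟪x, Δx⟫ + ‖R(D*x)‖² + re a·‖Qx‖²`), **`norm_sq_RDstar_le`** (`‖R(D*x)‖² ≤ re⟪x, Tx⟫ + K‖x‖²`),
  **`norm_sq_RDstar_le_of_coercive`** (`≤ (1 + K∕γ)·re⟪x, Tx⟫`), `norm_sq_Q_le_of_coercive` (`re a·‖Qx‖² ≤ (1 + K∕γ)·re⟪x, Tx⟫` — the `Q`-letter
  of `QG₁` is also `M_Q`-free).
MODEL ∕ HONEST SCOPE.  (M1) `E`, `F` finite-dimensional `𝕜`-Hilbert spaces, `S`, `V` `𝕜`-inner-product spaces; `Q* := Q†`.  (M2) displayed: `hpos`, `γ`;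
§3–§4 the symmetry of `T` (in the chain: unitary background + `*`-trace, `B9Eq326OperatorTower.laplaceAk_isSymmetric`); §4 the form letter `c_R` (§5
produces it from `K`); §2's `P`, `c_P` are whatever a STRONG coercivity supplies (`B9Thm311SmallFieldCoercivityTowerClosed`: the flat `D`-rows).  (M3) the
`L²` ∕ energy clause of Thm 3.13 ONLY: no kernel bound (3.42)–(3.47), no decay (Thm 3.10), no Hölder norms; crude constants (`2 + c_R`).  NOT summit
progress (cell pub-balaban: NE9 NOT PRINTED ∕ NOT PROVED; «NE9 ⇐ the named binders»; row WALLED ON A MODEL (O-NE9-1; #5 UNRULED); spine PROVED 0∕9; rung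
(B)+1 finite T⁴ — NOT infinite volume, NOT mass gap, NOT BetaPertH, NOT Clay).  HONEST DEPENDENCY (cell line): continuum YM on T⁴ ⇐ BetaPertH ∧ nine spine
estimates (0/9 proved); BetaPertH ⇐ (D1) ∧ (D4) ∧ CAP+tail; G-an2-4 gates asym, D1 and NE2/3/4.  NEW file importing `B9Eq3126GreenLettersVariational`
(ne9-leaf-02 g65) and `B11Eq111FrakG` (lit-balaban); nothing modified.  Net new unproved facts: 0.
-/

noncomputable section

open scoped InnerProductSpace ComplexConjugate BigOperators

namespace Literature.MathematicalPhysics.QuantumFieldTheory.Balaban1983to89.B9Eq3153FrakGVariational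

open B11Eq103H1Complex (laplaceAK laplaceAK_apply greenK apply_greenK greenK_apply G1K KinvK H1K laplaceAK_G1K laplaceAK_H1K Q_H1K)
open B11Eq111FrakG (frakGLin frakGLin_apply)
open B9Eq3126GreenLetters (norm_greenK_le)
open B9Eq3126GreenLettersVariational (re_inner_laplaceAK_H1K_le norm_H1K_sq_le_energy)

section Abstract

variable {𝕜 : Type*} [RCLike 𝕜] {E : Type*} [NormedAddCommGroup E] [InnerProductSpace 𝕜 E] [FiniteDimensional 𝕜 E]
  {F : Type*} [NormedAddCommGroup F] [InnerProductSpace 𝕜 F] [FiniteDimensional 𝕜 F] {S : Type*} [NormedAddCommGroup S] [InnerProductSpace 𝕜 S]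
  {V : Type*} [NormedAddCommGroup V] [InnerProductSpace 𝕜 V] {V₂ : Type*} [NormedAddCommGroup V₂] [InnerProductSpace 𝕜 V₂]
  {Δ : E →ₗ[𝕜] E} {D : S →ₗ[𝕜] E} {R : S →ₗ[𝕜] S} {Dstar : E →ₗ[𝕜] S} {Q : E →ₗ[𝕜] F} {a : 𝕜}
  (hpos : ∀ x : E, x ≠ 0 → 0 < RCLike.re ⟪x, laplaceAK Δ D R Dstar Q (LinearMap.adjoint Q) a x⟫_𝕜)
  (hadj : ∀ (x : E) (y : F), ⟪Q x, y⟫_𝕜 = ⟪x, LinearMap.adjoint Q y⟫_𝕜) (hinj : Function.Injective (LinearMap.adjoint Q))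
  {γ : ℝ} (hγ : 0 < γ) (hcoer : ∀ x : E, γ * ‖x‖ ^ 2 ≤ RCLike.re ⟪x, laplaceAK Δ D R Dstar Q (LinearMap.adjoint Q) a x⟫_𝕜)

/-- From `‖u‖² ≤ B²` with `0 ≤ B` to `‖u‖ ≤ B` (square roots). [folklore] -/
private theorem norm_le_of_sq_le {X : Type*} [NormedAddCommGroup X] (u : X) {B : ℝ} (hB : 0 ≤ B) (h : ‖u‖ ^ 2 ≤ B ^ 2) : ‖u‖ ≤ B := by
  have h2 := Real.sqrt_le_sqrt h
  rwa [Real.sqrt_sq (norm_nonneg _), Real.sqrt_sq hB] at h2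

/-! ## §1 `G₁` in the energy currency -/

include hγ hcoer in
/-- **`‖G₁y‖ ≤ γ⁻¹‖y‖`** for a `γ`-coercive `Δ_a` — [B9] Thm 3.4's `L²` clause for `G₁ = Δ_a⁻¹`, no operator bound of `Δ_a`
(`B9Eq3126GreenLetters.norm_greenK_le` BY NAME). [cite: Balaban1985BackgroundPropagators, Thm 3.4 p.400, Thm 3.11 p.416] -/
theorem norm_G1K_le (y : E) : ‖G1K Δ D R Dstar Q (LinearMap.adjoint Q) a hpos y‖ ≤ γ⁻¹ * ‖y‖ := by
  unfold G1K; exact norm_greenK_le hγ hcoer hpos y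

/-- **THE ENERGY OF `G₁y` IS `re⟪G₁y, y⟫`**: `re⟪G₁y, Δ_a(G₁y)⟫ = re⟪G₁y, y⟫` (`Δ_aG₁ = 1`). [folklore]
[cite: Balaban1985Variational, (110) p.294] -/
theorem re_inner_G1K_laplaceAK_G1K (y : E) :
    RCLike.re ⟪G1K Δ D R Dstar Q (LinearMap.adjoint Q) a hpos y,
        laplaceAK Δ D R Dstar Q (LinearMap.adjoint Q) a (G1K Δ D R Dstar Q (LinearMap.adjoint Q) a hpos y)⟫_𝕜 =
      RCLike.re ⟪G1K Δ D R Dstar Q (LinearMap.adjoint Q) a hpos y, y⟫_𝕜 := by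
  rw [laplaceAK_G1K]

include hcoer in
/-- `γ‖G₁y‖² ≤ re⟪G₁y, y⟫` (coercivity at `G₁y`). [folklore] [cite: Balaban1985BackgroundPropagators, Thm 3.11 p.416] -/
theorem sq_norm_G1K_le (y : E) :
    γ * ‖G1K Δ D R Dstar Q (LinearMap.adjoint Q) a hpos y‖ ^ 2 ≤ RCLike.re ⟪G1K Δ D R Dstar Q (LinearMap.adjoint Q) a hpos y, y⟫_𝕜 := by
  have h := hcoer (G1K Δ D R Dstar Q (LinearMap.adjoint Q) a hpos y)
  rwa [re_inner_G1K_laplaceAK_G1K] at h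

/-- `0 ≤ re⟪G₁y, y⟫` (the displayed positivity of `Δ_a` at `G₁y`). [folklore] [cite: Balaban1985BackgroundPropagators, Thm 3.11 p.416] -/
theorem re_inner_G1K_nonneg (y : E) : 0 ≤ RCLike.re ⟪G1K Δ D R Dstar Q (LinearMap.adjoint Q) a hpos y, y⟫_𝕜 := by
  rw [← re_inner_G1K_laplaceAK_G1K hpos]
  by_cases h : G1K Δ D R Dstar Q (LinearMap.adjoint Q) a hpos y = 0
  · rw [h, inner_zero_left, map_zero]
  · exact (hpos _ h).le

include hγ hcoer in
/-- **`re⟪G₁y, y⟫ ≤ γ⁻¹‖y‖²`** — the energy of `G₁y`, bounded by coercivity alone. [folklore]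
[cite: Balaban1985BackgroundPropagators, Thm 3.4 p.400, Thm 3.11 p.416] -/
theorem re_inner_G1K_le (y : E) : RCLike.re ⟪G1K Δ D R Dstar Q (LinearMap.adjoint Q) a hpos y, y⟫_𝕜 ≤ γ⁻¹ * ‖y‖ ^ 2 := by
  calc RCLike.re ⟪G1K Δ D R Dstar Q (LinearMap.adjoint Q) a hpos y, y⟫_𝕜
      ≤ ‖G1K Δ D R Dstar Q (LinearMap.adjoint Q) a hpos y‖ * ‖y‖ := re_inner_le_norm _ _
    _ ≤ γ⁻¹ * ‖y‖ * ‖y‖ := by gcongr; exact norm_G1K_le hpos hγ hcoer y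
    _ = γ⁻¹ * ‖y‖ ^ 2 := by ring

/-! ## §2 The sandwich: operators dominated by the energy -/

variable (P : E →ₗ[𝕜] V) {cP : ℝ} (hcP : 0 ≤ cP)
  (hP : ∀ x : E, ‖P x‖ ^ 2 ≤ cP * RCLike.re ⟪x, laplaceAK Δ D R Dstar Q (LinearMap.adjoint Q) a x⟫_𝕜)

include hP in
/-- `‖P(G₁y)‖² ≤ c_P·re⟪G₁y, y⟫` for an operator dominated by the energy. [folklore] [cite: Balaban1985BackgroundPropagators, Thm 3.11 p.416] -/
theorem norm_sq_apply_G1K_le (y : E) :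
    ‖P (G1K Δ D R Dstar Q (LinearMap.adjoint Q) a hpos y)‖ ^ 2 ≤ cP * RCLike.re ⟪G1K Δ D R Dstar Q (LinearMap.adjoint Q) a hpos y, y⟫_𝕜 := by
  have h := hP (G1K Δ D R Dstar Q (LinearMap.adjoint Q) a hpos y)
  rwa [re_inner_G1K_laplaceAK_G1K] at h

include hγ hcoer hcP hP in
/-- **`‖P(G₁y)‖ ≤ √(c_P∕γ)·‖y‖`** — a `D`-row of `G₁` from a strong coercivity, no operator bound of `D` or `Δ_a`. [folklore]
[cite: Balaban1985BackgroundPropagators, Thm 3.4 p.400, Thm 3.11 p.416] -/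
theorem norm_apply_G1K_le (y : E) : ‖P (G1K Δ D R Dstar Q (LinearMap.adjoint Q) a hpos y)‖ ≤ Real.sqrt (cP / γ) * ‖y‖ := by
  refine norm_le_of_sq_le _ (by positivity) ?_
  calc ‖P (G1K Δ D R Dstar Q (LinearMap.adjoint Q) a hpos y)‖ ^ 2
      ≤ cP * RCLike.re ⟪G1K Δ D R Dstar Q (LinearMap.adjoint Q) a hpos y, y⟫_𝕜 := norm_sq_apply_G1K_le hpos P hP y
    _ ≤ cP * (γ⁻¹ * ‖y‖ ^ 2) := mul_le_mul_of_nonneg_left (re_inner_G1K_le hpos hγ hcoer y) hcP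
    _ = (Real.sqrt (cP / γ) * ‖y‖) ^ 2 := by rw [mul_pow, Real.sq_sqrt (div_nonneg hcP hγ.le)]; ring

variable (P' : V →ₗ[𝕜] E) (hPP' : ∀ (x : E) (v : V), ⟪P x, v⟫_𝕜 = ⟪x, P' v⟫_𝕜)

include hcP hP hPP' in
/-- **THE ENERGY OF `G₁(P′v)` IS AT MOST `c_P‖v‖²`** for an adjoint pair `(P, P′)` with `P` dominated by the energy: with `u = P′v`, `E = re⟪G₁u, u⟫ =
re⟪P(G₁u), v⟫ ≤ ‖P(G₁u)‖‖v‖ ≤ √(c_P·E)‖v‖`. [folklore] [cite: Balaban1985BackgroundPropagators, Thm 3.11 p.416, (3.153) p.426] -/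
theorem re_inner_G1K_adj_le (v : V) :
    RCLike.re ⟪G1K Δ D R Dstar Q (LinearMap.adjoint Q) a hpos (P' v), P' v⟫_𝕜 ≤ cP * ‖v‖ ^ 2 := by
  set u := P' v with hu
  set En := RCLike.re ⟪G1K Δ D R Dstar Q (LinearMap.adjoint Q) a hpos u, u⟫_𝕜 with hEn
  have hE0 : 0 ≤ En := re_inner_G1K_nonneg hpos u
  have h1 : En ≤ ‖P (G1K Δ D R Dstar Q (LinearMap.adjoint Q) a hpos u)‖ * ‖v‖ := by
    have h : ⟪G1K Δ D R Dstar Q (LinearMap.adjoint Q) a hpos u, u⟫_𝕜 = ⟪P (G1K Δ D R Dstar Q (LinearMap.adjoint Q) a hpos u), v⟫_𝕜 := by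
      rw [hu, hPP']
    rw [hEn, h]
    exact re_inner_le_norm _ _
  have h2 : ‖P (G1K Δ D R Dstar Q (LinearMap.adjoint Q) a hpos u)‖ ^ 2 ≤ cP * En := norm_sq_apply_G1K_le hpos P hP u
  -- `En² ≤ ‖PG₁u‖²‖v‖² ≤ c_P·En·‖v‖²`
  have h3 : En * En ≤ (cP * ‖v‖ ^ 2) * En := by
    calc En * En ≤ (‖P (G1K Δ D R Dstar Q (LinearMap.adjoint Q) a hpos u)‖ * ‖v‖) * (‖P (G1K Δ D R Dstar Q (LinearMap.adjoint Q) a hpos u)‖ * ‖v‖) :=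
          mul_le_mul h1 h1 hE0 ((norm_nonneg _) |> fun h => mul_nonneg h (norm_nonneg _))
      _ = ‖P (G1K Δ D R Dstar Q (LinearMap.adjoint Q) a hpos u)‖ ^ 2 * ‖v‖ ^ 2 := by ring
      _ ≤ (cP * En) * ‖v‖ ^ 2 := mul_le_mul_of_nonneg_right h2 (sq_nonneg _)
      _ = (cP * ‖v‖ ^ 2) * En := by ring
  by_cases hE : En = 0
  · rw [hE]; positivity
  · exact le_of_mul_le_mul_right h3 (lt_of_le_of_ne hE0 (Ne.symm hE))

variable (P₂ : E →ₗ[𝕜] V₂) {c₂ : ℝ} (hc₂ : 0 ≤ c₂)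
  (hP₂ : ∀ x : E, ‖P₂ x‖ ^ 2 ≤ c₂ * RCLike.re ⟪x, laplaceAK Δ D R Dstar Q (LinearMap.adjoint Q) a x⟫_𝕜)

include hcP hP hPP' hc₂ hP₂ in
/-- **`‖P₂(G₁(P′v))‖ ≤ √(c₂·c_P)·‖v‖`** for a second operator `P₂` dominated by the energy (`‖P₂(G₁u)‖² ≤ c₂·E ≤ c₂c_P‖v‖²`). [folklore]
[cite: Balaban1985BackgroundPropagators, Thm 3.11 p.416, (3.153) p.426] -/
theorem norm_apply_G1K_adj_le' (v : V) : ‖P₂ (G1K Δ D R Dstar Q (LinearMap.adjoint Q) a hpos (P' v))‖ ≤ Real.sqrt (c₂ * cP) * ‖v‖ := by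
  refine norm_le_of_sq_le _ (by positivity) ?_
  calc ‖P₂ (G1K Δ D R Dstar Q (LinearMap.adjoint Q) a hpos (P' v))‖ ^ 2
      ≤ c₂ * RCLike.re ⟪G1K Δ D R Dstar Q (LinearMap.adjoint Q) a hpos (P' v), P' v⟫_𝕜 := norm_sq_apply_G1K_le hpos P₂ hP₂ (P' v)
    _ ≤ c₂ * (cP * ‖v‖ ^ 2) := mul_le_mul_of_nonneg_left (re_inner_G1K_adj_le hpos P hcP hP P' hPP' v) hc₂
    _ = (Real.sqrt (c₂ * cP) * ‖v‖) ^ 2 := by rw [mul_pow, Real.sq_sqrt (mul_nonneg hc₂ hcP)]; ring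

include hcP hP hPP' in
/-- `‖P(G₁(P′v))‖ ≤ c_P‖v‖` — the sandwich `PG₁P′` is bounded by the form letter alone. [folklore]
[cite: Balaban1985BackgroundPropagators, Thm 3.11 p.416, (3.153) p.426] -/
theorem norm_apply_G1K_adj_le (v : V) : ‖P (G1K Δ D R Dstar Q (LinearMap.adjoint Q) a hpos (P' v))‖ ≤ cP * ‖v‖ := by
  have h := norm_apply_G1K_adj_le' hpos P hcP hP P' hPP' P hcP hP v
  rwa [Real.sqrt_mul_self hcP] at h

include hγ hcoer hcP hP hPP' in
/-- **`‖G₁(P′v)‖ ≤ √(c_P∕γ)·‖v‖`** (`γ‖G₁u‖² ≤ E ≤ c_P‖v‖²`) — e.g. `‖G₁DR‖ ≤ √(c_R∕γ)` with no operator bound of `D`. [folklore]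
[cite: Balaban1985BackgroundPropagators, Thm 3.11 p.416, (3.153) p.426] -/
theorem norm_G1K_adj_le (v : V) : ‖G1K Δ D R Dstar Q (LinearMap.adjoint Q) a hpos (P' v)‖ ≤ Real.sqrt (cP / γ) * ‖v‖ := by
  refine norm_le_of_sq_le _ (by positivity) ?_
  have h1 := sq_norm_G1K_le hpos hcoer (P' v)
  have h2 := re_inner_G1K_adj_le hpos P hcP hP P' hPP' v
  calc ‖G1K Δ D R Dstar Q (LinearMap.adjoint Q) a hpos (P' v)‖ ^ 2
      = γ⁻¹ * (γ * ‖G1K Δ D R Dstar Q (LinearMap.adjoint Q) a hpos (P' v)‖ ^ 2) := by field_simp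
    _ ≤ γ⁻¹ * (cP * ‖v‖ ^ 2) := mul_le_mul_of_nonneg_left (h1.trans h2) (inv_nonneg.2 hγ.le)
    _ = (Real.sqrt (cP / γ) * ‖v‖) ^ 2 := by rw [mul_pow, Real.sq_sqrt (div_nonneg hcP hγ.le)]; ring

/-! ## §3 `H₁QG₁` with no `H₁` letter (symmetric `Δ_a`): the minimiser against the comparison configuration `G₁y` -/

variable (hTs : (laplaceAK Δ D R Dstar Q (LinearMap.adjoint Q) a).IsSymmetric)

include hTs in
/-- **THE ENERGY OF `H₁(Q(G₁y))` IS AT MOST `re⟪G₁y, y⟫`**: `H₁b` minimises the energy on `{Qx₀ = b}` ([B11] (45)) and `x₀ = G₁y` is admissible for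
`b = Q(G₁y)`. [folklore] [cite: Balaban1985Variational, (45) p.285; Balaban1985BackgroundPropagators, (3.126) p.420, (3.153) p.426] -/
theorem re_inner_H1K_Q_G1K_energy_le (y : E) :
    RCLike.re ⟪H1K hpos hadj hinj (Q (G1K Δ D R Dstar Q (LinearMap.adjoint Q) a hpos y)),
        laplaceAK Δ D R Dstar Q (LinearMap.adjoint Q) a (H1K hpos hadj hinj (Q (G1K Δ D R Dstar Q (LinearMap.adjoint Q) a hpos y)))⟫_𝕜 ≤
      RCLike.re ⟪G1K Δ D R Dstar Q (LinearMap.adjoint Q) a hpos y, y⟫_𝕜 := by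
  rw [← re_inner_G1K_laplaceAK_G1K hpos]
  exact re_inner_laplaceAK_H1K_le hpos hadj hinj hTs rfl

include hγ hcoer hTs in
/-- **`‖H₁(Q(G₁y))‖ ≤ γ⁻¹‖y‖`** — the second piece of (3.153) bounded by coercivity alone (`‖H₁b‖² ≤ γ⁻¹·energy ≤ γ⁻¹·re⟪G₁y, y⟫ ≤ γ⁻²‖y‖²`;
leaf-02's `norm_H1K_sq_le_energy` BY NAME). [folklore] [cite: Balaban1985Variational, (45)–(46) p.285; Balaban1985BackgroundPropagators, (3.153) p.426] -/
theorem norm_H1K_Q_G1K_le (y : E) : ‖H1K hpos hadj hinj (Q (G1K Δ D R Dstar Q (LinearMap.adjoint Q) a hpos y))‖ ≤ γ⁻¹ * ‖y‖ := by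
  refine norm_le_of_sq_le _ (by positivity) ?_
  calc ‖H1K hpos hadj hinj (Q (G1K Δ D R Dstar Q (LinearMap.adjoint Q) a hpos y))‖ ^ 2
      ≤ γ⁻¹ * RCLike.re ⟪G1K Δ D R Dstar Q (LinearMap.adjoint Q) a hpos y,
          laplaceAK Δ D R Dstar Q (LinearMap.adjoint Q) a (G1K Δ D R Dstar Q (LinearMap.adjoint Q) a hpos y)⟫_𝕜 :=
        norm_H1K_sq_le_energy hpos hadj hinj hγ hcoer hTs rfl
    _ = γ⁻¹ * RCLike.re ⟪G1K Δ D R Dstar Q (LinearMap.adjoint Q) a hpos y, y⟫_𝕜 := by rw [re_inner_G1K_laplaceAK_G1K]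
    _ ≤ γ⁻¹ * (γ⁻¹ * ‖y‖ ^ 2) := mul_le_mul_of_nonneg_left (re_inner_G1K_le hpos hγ hcoer y) (inv_nonneg.2 hγ.le)
    _ = (γ⁻¹ * ‖y‖) ^ 2 := by ring

include hγ hcoer hcP hP hTs in
/-- **`‖P(H₁(Q(G₁y)))‖ ≤ √(c_P∕γ)·‖y‖`** — a `D`-row of the second piece (`‖Ph‖² ≤ c_P·energy(h) ≤ c_P·re⟪G₁y, y⟫`). [folklore]
[cite: Balaban1985Variational, (45) p.285; Balaban1985BackgroundPropagators, (3.153) p.426] -/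
theorem norm_apply_H1K_Q_G1K_le (y : E) :
    ‖P (H1K hpos hadj hinj (Q (G1K Δ D R Dstar Q (LinearMap.adjoint Q) a hpos y)))‖ ≤ Real.sqrt (cP / γ) * ‖y‖ := by
  refine norm_le_of_sq_le _ (by positivity) ?_
  calc ‖P (H1K hpos hadj hinj (Q (G1K Δ D R Dstar Q (LinearMap.adjoint Q) a hpos y)))‖ ^ 2
      ≤ cP * RCLike.re ⟪H1K hpos hadj hinj (Q (G1K Δ D R Dstar Q (LinearMap.adjoint Q) a hpos y)),
          laplaceAK Δ D R Dstar Q (LinearMap.adjoint Q) a (H1K hpos hadj hinj (Q (G1K Δ D R Dstar Q (LinearMap.adjoint Q) a hpos y)))⟫_𝕜 := hP _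
    _ ≤ cP * RCLike.re ⟪G1K Δ D R Dstar Q (LinearMap.adjoint Q) a hpos y, y⟫_𝕜 :=
        mul_le_mul_of_nonneg_left (re_inner_H1K_Q_G1K_energy_le hpos hadj hinj hTs y) hcP
    _ ≤ cP * (γ⁻¹ * ‖y‖ ^ 2) := mul_le_mul_of_nonneg_left (re_inner_G1K_le hpos hγ hcoer y) hcP
    _ = (Real.sqrt (cP / γ) * ‖y‖) ^ 2 := by rw [mul_pow, Real.sq_sqrt (div_nonneg hcP hγ.le)]; ring

/-! ## §4 The third Green's letter `𝔊 = G₁ − H₁QG₁ − G₁DRD*G₁` (3.153) in the energy currency -/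

variable (hDD : ∀ (s : S) (x : E), ⟪D s, x⟫_𝕜 = ⟪s, Dstar x⟫_𝕜) (hRsym : ∀ s t : S, ⟪R s, t⟫_𝕜 = ⟪s, R t⟫_𝕜) (hRR : ∀ s : S, R (R s) = R s)
  {cR : ℝ} (hcR : 0 ≤ cR) (hRD : ∀ x : E, ‖R (Dstar x)‖ ^ 2 ≤ cR * RCLike.re ⟪x, laplaceAK Δ D R Dstar Q (LinearMap.adjoint Q) a x⟫_𝕜)

/-- **(3.153) READ WITH `H₁`**: `𝔊x = G₁x − H₁(Q(G₁x)) − G₁(D(R(D*(G₁x))))` (`H₁ = G₁Q†(QG₁Q†)⁻¹`, `B11Eq111FrakG.frakGLin_apply`). [folklore]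
[cite: Balaban1985BackgroundPropagators, (3.153) p.426, (3.126) p.420] -/
theorem frakGLin_apply_H1K (x : E) :
    frakGLin (G1K Δ D R Dstar Q (LinearMap.adjoint Q) a hpos) Q (LinearMap.adjoint Q) (KinvK hpos hadj hinj) D R Dstar x =
      G1K Δ D R Dstar Q (LinearMap.adjoint Q) a hpos x - H1K hpos hadj hinj (Q (G1K Δ D R Dstar Q (LinearMap.adjoint Q) a hpos x)) -
        G1K Δ D R Dstar Q (LinearMap.adjoint Q) a hpos (D (R (Dstar (G1K Δ D R Dstar Q (LinearMap.adjoint Q) a hpos x)))) := by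
  rw [frakGLin_apply]; rfl

omit [FiniteDimensional 𝕜 E] in
include hDD hRsym in
/-- The adjoint pair of §2 for the third piece: `⟪R(D*x), s⟫ = ⟪x, D(Rs)⟫`. [folklore] [cite: Balaban1985BackgroundPropagators, (3.8) p.392, (3.21) p.394] -/
theorem inner_RDstar_eq (x : E) (s : S) : ⟪(R ∘ₗ Dstar) x, s⟫_𝕜 = ⟪x, (D ∘ₗ R) s⟫_𝕜 := by
  rw [LinearMap.comp_apply, LinearMap.comp_apply, hRsym, ← inner_conj_symm, ← hDD, inner_conj_symm]

include hγ hcoer hTs hDD hRsym hRR hcR hRD in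
/-- **`‖𝔊x‖ ≤ (2 + c_R)·γ⁻¹·‖x‖` — [B9] THM 3.13's `L²` CLAUSE FOR `𝔊` THROUGH (3.153), FROM THE COERCIVITY CONSTANT `γ` AND THE FORM LETTER `c_R` ALONE**:
`‖G₁x‖ ≤ γ⁻¹‖x‖`; `‖H₁QG₁x‖ ≤ γ⁻¹‖x‖` (§3); `‖G₁DR·z‖ ≤ √(c_R∕γ)‖z‖` and `‖z‖ = ‖RD*G₁x‖ ≤ √(c_R∕γ)‖x‖` (§2, `R² = R`).  No operator bound of `Δ_a`,
`D`, `Q`, no `H₁` ∕ `(QG₁Q†)⁻¹` letter, no volume. [cite: Balaban1985BackgroundPropagators, Thm 3.13 p.426, (3.153) p.426, Thm 3.11 p.416] -/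
theorem norm_frakGLin_le_of_energy (x : E) :
    ‖frakGLin (G1K Δ D R Dstar Q (LinearMap.adjoint Q) a hpos) Q (LinearMap.adjoint Q) (KinvK hpos hadj hinj) D R Dstar x‖ ≤
      (2 + cR) * γ⁻¹ * ‖x‖ := by
  have hPP' : ∀ (x : E) (s : S), ⟪(R ∘ₗ Dstar) x, s⟫_𝕜 = ⟪x, (D ∘ₗ R) s⟫_𝕜 := inner_RDstar_eq hDD hRsym
  have hP0 : ∀ x : E, ‖(R ∘ₗ Dstar) x‖ ^ 2 ≤ cR * RCLike.re ⟪x, laplaceAK Δ D R Dstar Q (LinearMap.adjoint Q) a x⟫_𝕜 := fun x => hRD x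
  set G := G1K Δ D R Dstar Q (LinearMap.adjoint Q) a hpos with hG
  set z := R (Dstar (G x)) with hz
  have h1 : ‖G x‖ ≤ γ⁻¹ * ‖x‖ := norm_G1K_le hpos hγ hcoer x
  have h2 : ‖H1K hpos hadj hinj (Q (G x))‖ ≤ γ⁻¹ * ‖x‖ := norm_H1K_Q_G1K_le hpos hadj hinj hγ hcoer hTs x
  have hz' : ‖z‖ ≤ Real.sqrt (cR / γ) * ‖x‖ := by
    have h := norm_apply_G1K_le hpos hγ hcoer (R ∘ₗ Dstar) hcR hP0 x
    rwa [LinearMap.comp_apply] at h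
  have h3 : ‖G (D (R (Dstar (G x))))‖ ≤ cR / γ * ‖x‖ := by
    have hrew : D (R (Dstar (G x))) = (D ∘ₗ R) z := by rw [LinearMap.comp_apply, hz, hRR]
    rw [hrew]
    calc ‖G ((D ∘ₗ R) z)‖ ≤ Real.sqrt (cR / γ) * ‖z‖ := norm_G1K_adj_le hpos hγ hcoer (R ∘ₗ Dstar) hcR hP0 (D ∘ₗ R) hPP' z
      _ ≤ Real.sqrt (cR / γ) * (Real.sqrt (cR / γ) * ‖x‖) := mul_le_mul_of_nonneg_left hz' (Real.sqrt_nonneg _)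
      _ = cR / γ * ‖x‖ := by rw [← mul_assoc, Real.mul_self_sqrt (div_nonneg hcR hγ.le)]
  rw [frakGLin_apply_H1K]
  calc ‖G x - H1K hpos hadj hinj (Q (G x)) - G (D (R (Dstar (G x))))‖
      ≤ ‖G x‖ + ‖H1K hpos hadj hinj (Q (G x))‖ + ‖G (D (R (Dstar (G x))))‖ := norm_sub_le_of_le (norm_sub_le _ _) le_rfl
    _ ≤ γ⁻¹ * ‖x‖ + γ⁻¹ * ‖x‖ + cR / γ * ‖x‖ := by gcongr
    _ = (2 + cR) * γ⁻¹ * ‖x‖ := by rw [div_eq_mul_inv]; ring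

include hγ hcoer hcP hP hTs hDD hRsym hRR hcR hRD in
/-- **`‖P(𝔊x)‖ ≤ (2 + c_R)·√(c_P∕γ)·‖x‖` — THE `D`-ROWS OF `𝔊`** for any operator dominated by the energy: each piece of (3.153) separately
(§2 `norm_apply_G1K_le`, §3 `norm_apply_H1K_Q_G1K_le`, §2 `norm_apply_G1K_adj_le'` with `√(c_Pc_R)·√(c_R∕γ) = c_R√(c_P∕γ)`).  [B9] Thm 3.13 «Theorems
3.3, 3.11 hold for 𝔊» — its `L²`-Sobolev shadow, no kernel bound, no decay. [cite: Balaban1985BackgroundPropagators, Thm 3.13 p.426, (3.153) p.426] -/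
theorem norm_apply_frakGLin_le_of_energy (x : E) :
    ‖P (frakGLin (G1K Δ D R Dstar Q (LinearMap.adjoint Q) a hpos) Q (LinearMap.adjoint Q) (KinvK hpos hadj hinj) D R Dstar x)‖ ≤
      (2 + cR) * Real.sqrt (cP / γ) * ‖x‖ := by
  have hPP' : ∀ (x : E) (s : S), ⟪(R ∘ₗ Dstar) x, s⟫_𝕜 = ⟪x, (D ∘ₗ R) s⟫_𝕜 := inner_RDstar_eq hDD hRsym
  have hP0 : ∀ x : E, ‖(R ∘ₗ Dstar) x‖ ^ 2 ≤ cR * RCLike.re ⟪x, laplaceAK Δ D R Dstar Q (LinearMap.adjoint Q) a x⟫_𝕜 := fun x => hRD x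
  set G := G1K Δ D R Dstar Q (LinearMap.adjoint Q) a hpos with hG
  set z := R (Dstar (G x)) with hz
  have h1 : ‖P (G x)‖ ≤ Real.sqrt (cP / γ) * ‖x‖ := norm_apply_G1K_le hpos hγ hcoer P hcP hP x
  have h2 : ‖P (H1K hpos hadj hinj (Q (G x)))‖ ≤ Real.sqrt (cP / γ) * ‖x‖ := norm_apply_H1K_Q_G1K_le hpos hadj hinj hγ hcoer P hcP hP hTs x
  have hz' : ‖z‖ ≤ Real.sqrt (cR / γ) * ‖x‖ := by
    have h := norm_apply_G1K_le hpos hγ hcoer (R ∘ₗ Dstar) hcR hP0 x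
    rwa [LinearMap.comp_apply] at h
  have hsq : Real.sqrt (cP * cR) * Real.sqrt (cR / γ) = cR * Real.sqrt (cP / γ) := by
    rw [← Real.sqrt_mul (mul_nonneg hcP hcR), show cP * cR * (cR / γ) = cR ^ 2 * (cP / γ) by ring,
      Real.sqrt_mul (sq_nonneg _), Real.sqrt_sq hcR]
  have h3 : ‖P (G (D (R (Dstar (G x)))))‖ ≤ cR * Real.sqrt (cP / γ) * ‖x‖ := by
    have hrew : D (R (Dstar (G x))) = (D ∘ₗ R) z := by rw [LinearMap.comp_apply, hz, hRR]
    rw [hrew]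
    calc ‖P (G ((D ∘ₗ R) z))‖ ≤ Real.sqrt (cP * cR) * ‖z‖ := norm_apply_G1K_adj_le' hpos (R ∘ₗ Dstar) hcR hP0 (D ∘ₗ R) hPP' P hcP hP z
      _ ≤ Real.sqrt (cP * cR) * (Real.sqrt (cR / γ) * ‖x‖) := mul_le_mul_of_nonneg_left hz' (Real.sqrt_nonneg _)
      _ = cR * Real.sqrt (cP / γ) * ‖x‖ := by rw [← mul_assoc, hsq]
  rw [frakGLin_apply_H1K, map_sub, map_sub]
  calc ‖P (G x) - P (H1K hpos hadj hinj (Q (G x))) - P (G (D (R (Dstar (G x)))))‖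
      ≤ ‖P (G x)‖ + ‖P (H1K hpos hadj hinj (Q (G x)))‖ + ‖P (G (D (R (Dstar (G x)))))‖ := norm_sub_le_of_le (norm_sub_le _ _) le_rfl
    _ ≤ Real.sqrt (cP / γ) * ‖x‖ + Real.sqrt (cP / γ) * ‖x‖ + cR * Real.sqrt (cP / γ) * ‖x‖ := by gcongr
    _ = (2 + cR) * Real.sqrt (cP / γ) * ‖x‖ := by ring

/-! ## §5 The form letter `‖R(D*x)‖² ≤ c_R·re⟪x, Δ_a x⟫` from the structure `Δ_a = Δ + DRD* + aQ†Q` -/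

variable {K : ℝ} (hΔ : ∀ x : E, -(K * ‖x‖ ^ 2) ≤ RCLike.re ⟪x, Δ x⟫_𝕜) (ha : 0 ≤ RCLike.re a)

include hadj hDD hRsym hRR in
/-- **`re⟪x, Δ_a x⟫ = re⟪x, Δx⟫ + ‖R(D*x)‖² + re a·‖Qx‖²`** — the quadratic form of `Δ_a = Δ + DRD* + aQ†Q` for an adjoint pair `(D, D*)`, a
symmetric idempotent `R` and `Q* = Q†` ([B11] p. 293's «scalar product defined by the operator Δ₁ + D*RD + aQ*Q»). [folklore]
[cite: Balaban1985Variational, (110) p.294, p.293; Balaban1985BackgroundPropagators, (3.26) p.395] -/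
theorem re_inner_laplaceAK_eq (x : E) :
    RCLike.re ⟪x, laplaceAK Δ D R Dstar Q (LinearMap.adjoint Q) a x⟫_𝕜 = RCLike.re ⟪x, Δ x⟫_𝕜 + ‖R (Dstar x)‖ ^ 2 + RCLike.re a * ‖Q x‖ ^ 2 := by
  have h1' : ⟪R (Dstar x), Dstar x⟫_𝕜 = ⟪R (Dstar x), R (Dstar x)⟫_𝕜 := by
    conv_lhs => rw [← hRR (Dstar x)]
    exact hRsym _ _
  have h1 : ⟪x, D (R (Dstar x))⟫_𝕜 = ((‖R (Dstar x)‖ : ℝ) : 𝕜) ^ 2 := by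
    rw [← inner_conj_symm, hDD, h1', inner_self_eq_norm_sq_to_K, map_pow, RCLike.conj_ofReal]
  have h2 : ⟪x, LinearMap.adjoint Q (a • Q x)⟫_𝕜 = a * ((‖Q x‖ : ℝ) : 𝕜) ^ 2 := by
    rw [← hadj, inner_smul_right, inner_self_eq_norm_sq_to_K]
  rw [laplaceAK_apply, inner_add_right, inner_add_right, map_add, map_add, h1, h2]
  simp only [← RCLike.ofReal_pow, RCLike.ofReal_re, RCLike.re_mul_ofReal]

include hadj hDD hRsym hRR hΔ ha in
/-- **`‖R(D*x)‖² ≤ re⟪x, Δ_a x⟫ + K‖x‖²`** when `re⟪x, Δx⟫ ≥ −K‖x‖²` and `re a ≥ 0` (in the chain: `Δ = D*D + Δ′(U)` with the curvature form `≥ −K_cα‖x‖²`,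
`B9Ineq369CurvatureSmall`; `K = 0` at the flat background). [folklore] [cite: Balaban1985BackgroundPropagators, (3.26) p.395, (3.69) p.404] -/
theorem norm_sq_RDstar_le (x : E) : ‖R (Dstar x)‖ ^ 2 ≤ RCLike.re ⟪x, laplaceAK Δ D R Dstar Q (LinearMap.adjoint Q) a x⟫_𝕜 + K * ‖x‖ ^ 2 := by
  rw [re_inner_laplaceAK_eq hadj hDD hRsym hRR]
  have h0 : 0 ≤ RCLike.re a * ‖Q x‖ ^ 2 := by positivity
  linarith [hΔ x]

include hadj hDD hRsym hRR hΔ ha hγ hcoer in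
/-- **`‖R(D*x)‖² ≤ (1 + K∕γ)·re⟪x, Δ_a x⟫`** — the form letter `c_R` of §4 for a `γ`-coercive `Δ_a` (`K‖x‖² ≤ (K∕γ)·re⟪x, Δ_a x⟫`). [folklore]
[cite: Balaban1985BackgroundPropagators, (3.26) p.395, Thm 3.11 p.416] -/
theorem norm_sq_RDstar_le_of_coercive (hK : 0 ≤ K) (x : E) :
    ‖R (Dstar x)‖ ^ 2 ≤ (1 + K / γ) * RCLike.re ⟪x, laplaceAK Δ D R Dstar Q (LinearMap.adjoint Q) a x⟫_𝕜 := by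
  have h1 := norm_sq_RDstar_le hadj hDD hRsym hRR hΔ ha x
  have h2 : K * ‖x‖ ^ 2 ≤ K / γ * RCLike.re ⟪x, laplaceAK Δ D R Dstar Q (LinearMap.adjoint Q) a x⟫_𝕜 := by
    rw [div_mul_eq_mul_div, le_div_iff₀ hγ]
    calc K * ‖x‖ ^ 2 * γ = K * (γ * ‖x‖ ^ 2) := by ring
      _ ≤ K * RCLike.re ⟪x, laplaceAK Δ D R Dstar Q (LinearMap.adjoint Q) a x⟫_𝕜 := mul_le_mul_of_nonneg_left (hcoer x) hK
  linarith

include hadj hDD hRsym hRR hΔ hγ hcoer in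
/-- `re a·‖Qx‖² ≤ (1 + K∕γ)·re⟪x, Δ_a x⟫` — the `Q`-letter of `QG₁` in the energy currency (`‖Q(G₁y)‖² ≤ (re a)⁻¹(1 + K∕γ)γ⁻¹‖y‖²` by §2), `M_Q`-free.
[folklore] [cite: Balaban1985BackgroundPropagators, (3.26) p.395, Thm 3.11 p.416] -/
theorem norm_sq_Q_le_of_coercive (hK : 0 ≤ K) (x : E) :
    RCLike.re a * ‖Q x‖ ^ 2 ≤ (1 + K / γ) * RCLike.re ⟪x, laplaceAK Δ D R Dstar Q (LinearMap.adjoint Q) a x⟫_𝕜 := by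
  have h0 := re_inner_laplaceAK_eq (Δ := Δ) (a := a) hadj hDD hRsym hRR x
  have h1 : 0 ≤ ‖R (Dstar x)‖ ^ 2 := sq_nonneg _
  have h2 : K * ‖x‖ ^ 2 ≤ K / γ * RCLike.re ⟪x, laplaceAK Δ D R Dstar Q (LinearMap.adjoint Q) a x⟫_𝕜 := by
    rw [div_mul_eq_mul_div, le_div_iff₀ hγ]
    calc K * ‖x‖ ^ 2 * γ = K * (γ * ‖x‖ ^ 2) := by ring
      _ ≤ K * RCLike.re ⟪x, laplaceAK Δ D R Dstar Q (LinearMap.adjoint Q) a x⟫_𝕜 := mul_le_mul_of_nonneg_left (hcoer x) hK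
  have h3 := hΔ x
  linarith

end Abstract

end Literature.MathematicalPhysics.QuantumFieldTheory.Balaban1983to89.B9Eq3153FrakGVariational

end
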